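import Mathlib
import Summits.AtomisticToContinuum.Crystallization.Theorems.ChessboardParticlePlanesLjLaminarWindowsSparseAllSpikyA
import HarnessLib

/-! # All-spiky neighbourhoods are impossible in the sparse regime, part C — the diffuse core of stub
`stub_sparseAllSpiky` of line `Sketch` (skeleton rev. 14a, lead c8), crux `LjLaminarWindows`
(stmt-AtomisticToContinuum-6711)

The purely combinatorial end of Stage B (`sparse_core`): ring shells `SH i`, `i < m`, each holding
`≥ σ₀ = θ · 20L/23` particles, split into a heavy part of total size `≤ 344 M₁ L` and a diffuse part
inside a set `Xl` of size `≤ M₁ L` all of whose `r₁`-balls hold `< c₂ L` particles; if moreover the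
common part of any three distinct shells lies in two `r₁`-balls, then `m θ ≥ 800 M₁` and
`c₂ = θ/(6m³)` are contradictory: two Bonferroni steps produce two distinct thick circles sharing
`≥ σ₀/(2m³) > 2 c₂ L` diffuse particles. -/

noncomputable section

open scoped BigOperators
open Filter Topology
open Literature.MathematicalPhysics.StatisticalMechanics
open Summit.AtomisticToContinuum.Crystallization.Theorems.ChargedEnergyGapNegative

namespace Summit.AtomisticToContinuum.Crystallization.Theorems.LjLaminarWindowsSketch

/-- Sum over the strictly ordered pairs of `range m × range m` as an iterated triangular sum.
[folklore] -/
theorem sparse_sum_pairs (m : ℕ) (g : ℕ × ℕ → ℝ) :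
    ∑ p ∈ (Finset.range m ×ˢ Finset.range m).filter (fun p : ℕ × ℕ => p.2 < p.1), g p =
      ∑ i ∈ Finset.range m, ∑ j ∈ Finset.range i, g (i, j) := by
  rw [Finset.sum_filter, Finset.sum_product]
  refine Finset.sum_congr rfl fun i hi => ?_
  have hi' := Finset.mem_range.1 hi
  rw [← Finset.sum_filter]
  refine Finset.sum_congr ?_ fun _ _ => rfl
  ext j
  simp only [Finset.mem_filter, Finset.mem_range]
  omega

/-- The strictly ordered pairs of `range m × range m` number at most `m²`. [folklore] -/
theorem sparse_card_pairs (m : ℕ) :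
    ((((Finset.range m ×ˢ Finset.range m).filter (fun p : ℕ × ℕ => p.2 < p.1)).card : ℝ)) ≤
      (m : ℝ) ^ 2 := by
  have h : ((Finset.range m ×ˢ Finset.range m).filter (fun p : ℕ × ℕ => p.2 < p.1)).card ≤ m * m := by
    calc _ ≤ (Finset.range m ×ˢ Finset.range m).card := Finset.card_filter_le _ _
      _ = m * m := by rw [Finset.card_product, Finset.card_range]
  calc _ ≤ ((m * m : ℕ) : ℝ) := by exact_mod_cast h
    _ = (m : ℝ) ^ 2 := by push_cast; ring

/-- The final arithmetic: `2 c₂ L < (m σ₀ / 2) / m⁴` for `σ₀ = θ · L/(23/20)`, `c₂ = θ/(6 m³)`.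
[folklore] -/
theorem sparse_final_ineq :
    ∀ {θ L σ₀ c₂ : ℝ} {m : ℕ}, 0 < θ → 0 < L → (0 : ℝ) < m →
      σ₀ = θ * (L / (23 / 20)) → c₂ = θ / (6 * (m : ℝ) ^ 3) →
      2 * (c₂ * L) < (m : ℝ) * σ₀ / 2 / (m : ℝ) ^ 4 := by
  intro θ L σ₀ c₂ m hθ hL hm hσ₀ hc₂
  rw [hc₂, hσ₀]
  have hm3 : (0 : ℝ) < (m : ℝ) ^ 3 := by positivity
  have e1 : 2 * (θ / (6 * (m : ℝ) ^ 3) * L) = (1 / 3) * (θ * L / (m : ℝ) ^ 3) := by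
    field_simp
    ring
  have e2 : (m : ℝ) * (θ * (L / (23 / 20))) / 2 / (m : ℝ) ^ 4 = (10 / 23) * (θ * L / (m : ℝ) ^ 3) := by
    field_simp
    ring
  rw [e1, e2]
  have : 0 < θ * L / (m : ℝ) ^ 3 := by positivity
  nlinarith

/-- **Diffuse core of Stage B.** See the module docstring. [folklore] -/
theorem sparse_core {N : ℕ} (x : Fin N → E3)
    (hBonf : ∀ (N' n : ℕ) (A : ℕ → Finset (Fin N')),
      ∑ i ∈ Finset.range n, ((A i).card : ℝ) ≤
        (((Finset.range n).biUnion A).card : ℝ) +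
          ∑ i ∈ Finset.range n, ∑ j ∈ Finset.range i, ((A i ∩ A j).card : ℝ))
    (m : ℕ) (SH : ℕ → Finset (Fin N)) (Xh Xl : Finset (Fin N)) {θ L M₁ σ₀ c₂ r₁ : ℝ}
    (hθ : 0 < θ) (hL : 0 < L) (hm2 : (2 : ℝ) ≤ m) (hmθ : 800 * M₁ ≤ (m : ℝ) * θ)
    (hσ₀ : σ₀ = θ * (L / (23 / 20))) (hc₂ : c₂ = θ / (6 * (m : ℝ) ^ 3))
    (hshell : ∀ i < m, σ₀ ≤ ((SH i).card : ℝ))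
    (hsplit : ∀ i < m, ((SH i).card : ℝ) = ((SH i ∩ Xh).card : ℝ) + ((SH i ∩ Xl).card : ℝ))
    (hheavy : ∑ i ∈ Finset.range m, ((SH i ∩ Xh).card : ℝ) ≤ 344 * (M₁ * L))
    (hXlcard : (Xl.card : ℝ) ≤ M₁ * L)
    (hlight : ∀ z : E3, ((Xl.filter fun j => dist (x j) z ≤ r₁).card : ℝ) < c₂ * L)
    (hTT3 : ∀ i < m, ∀ j < m, ∀ c < m, i ≠ j → i ≠ c → j ≠ c → ∃ y₁ y₂ : E3,
      ∀ q ∈ SH i ∩ SH j ∩ SH c, dist (x q) y₁ ≤ r₁ ∨ dist (x q) y₂ ≤ r₁) : False := by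
  classical
  have hm0 : (0 : ℝ) < m := by linarith only [hm2]
  have hσ₀0 : 0 < σ₀ := by rw [hσ₀]; positivity
  /- (4) the diffuse service is large -/
  have hdiffuse : (m : ℝ) * σ₀ - 344 * (M₁ * L) ≤ ∑ i ∈ Finset.range m, ((SH i ∩ Xl).card : ℝ) := by
    have h1 : (m : ℝ) * σ₀ ≤ ∑ i ∈ Finset.range m, ((SH i).card : ℝ) := by
      have h := Finset.sum_le_sum fun i hi => hshell i (Finset.mem_range.1 hi)
      rw [Finset.sum_const, Finset.card_range, nsmul_eq_mul] at h
      exact h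
    have h2 : ∑ i ∈ Finset.range m, ((SH i).card : ℝ) =
        ∑ i ∈ Finset.range m, ((SH i ∩ Xh).card : ℝ) +
          ∑ i ∈ Finset.range m, ((SH i ∩ Xl).card : ℝ) := by
      rw [← Finset.sum_add_distrib]
      exact Finset.sum_congr rfl fun i hi => hsplit i (Finset.mem_range.1 hi)
    linarith only [h1, h2, hheavy]
  /- (5) Bonferroni over the diffuse shells -/
  have hlevel2 : (m : ℝ) * σ₀ - 345 * (M₁ * L) ≤
      ∑ i ∈ Finset.range m, ∑ j ∈ Finset.range i, (((SH i ∩ Xl) ∩ (SH j ∩ Xl)).card : ℝ) := by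
    have hB := hBonf N m (fun i => SH i ∩ Xl)
    have hU : (((Finset.range m).biUnion fun i => SH i ∩ Xl).card : ℝ) ≤ M₁ * L := by
      refine le_trans ?_ hXlcard
      exact_mod_cast Finset.card_le_card
        (Finset.biUnion_subset.2 fun i _ => Finset.inter_subset_right)
    linarith only [hB, hU, hdiffuse]
  /- (6) Bonferroni over the thick circles: two distinct pairs sharing many diffuse particles -/
  set s : Finset (ℕ × ℕ) := (Finset.range m ×ˢ Finset.range m).filter (fun p : ℕ × ℕ => p.2 < p.1)
    with hs
  obtain ⟨A, hA⟩ : ∃ A : ℕ × ℕ → Finset (Fin N), ∀ p, A p = (SH p.1 ∩ Xl) ∩ (SH p.2 ∩ Xl) :=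
    ⟨_, fun _ => rfl⟩
  obtain ⟨Λ, hΛ⟩ : ∃ Λ : ℝ, Λ = (m : ℝ) * σ₀ - 346 * (M₁ * L) := ⟨_, rfl⟩
  have hΛbig : (m : ℝ) * σ₀ / 2 ≤ Λ := by
    rw [hΛ, hσ₀]
    have h1 : (m : ℝ) * (θ * (L / (23 / 20))) / 2 = 10 / 23 * ((m : ℝ) * θ) * L := by ring
    have h2 : (m : ℝ) * (θ * (L / (23 / 20))) = 20 / 23 * ((m : ℝ) * θ) * L := by ring
    rw [h1, h2]
    nlinarith only [mul_le_mul_of_nonneg_left hmθ hL.le, mul_pos hL (mul_pos hm0 hθ)]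
  have hΛ0 : 0 < Λ := by
    have : 0 < (m : ℝ) * σ₀ / 2 := by positivity
    linarith only [this, hΛbig]
  have hsumA : ∑ p ∈ s, ((A p).card : ℝ) =
      ∑ i ∈ Finset.range m, ∑ j ∈ Finset.range i, (((SH i ∩ Xl) ∩ (SH j ∩ Xl)).card : ℝ) := by
    rw [hs, sparse_sum_pairs m (fun p => ((A p).card : ℝ))]
    simp only [hA]
  obtain ⟨p, hp, p', hp', hpp', hbig⟩ := sparse_two_labels hBonf s A Xl hΛ0
    (fun p _ => by rw [hA p]; exact Finset.inter_subset_right.trans Finset.inter_subset_right)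
    (by rw [hsumA, hΛ]; linarith only [hlevel2, hXlcard])
  -- unpack the two pairs
  have hp1 : p.1 < m := Finset.mem_range.1 (Finset.mem_product.1 (Finset.mem_filter.1 hp).1).1
  have hp2 : p.2 < p.1 := (Finset.mem_filter.1 hp).2
  have hp'1 : p'.1 < m := Finset.mem_range.1 (Finset.mem_product.1 (Finset.mem_filter.1 hp').1).1
  have hp'2 : p'.2 < p'.1 := (Finset.mem_filter.1 hp').2
  have hscard : (0 : ℝ) < s.card := by
    have : 0 < s.card := Finset.card_pos.2 ⟨p, hp⟩
    exact_mod_cast this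
  have hbig' : (m : ℝ) * σ₀ / 2 / (m : ℝ) ^ 4 ≤ ((A p ∩ A p').card : ℝ) := by
    have hs2 : (s.card : ℝ) ^ 2 ≤ (m : ℝ) ^ 4 := by
      have h := sparse_card_pairs m
      calc (s.card : ℝ) ^ 2 ≤ ((m : ℝ) ^ 2) ^ 2 := by gcongr
        _ = (m : ℝ) ^ 4 := by ring
    calc (m : ℝ) * σ₀ / 2 / (m : ℝ) ^ 4 ≤ Λ / (m : ℝ) ^ 4 := by gcongr
      _ ≤ Λ / (s.card : ℝ) ^ 2 := div_le_div_of_nonneg_left hΛ0.le (by positivity) hs2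
      _ ≤ _ := hbig
  /- (7) a third centre and the two small balls -/
  have hne : (p.1, p.2) ≠ (p'.1, p'.2) := by
    intro h
    exact hpp' (Prod.ext (Prod.mk.injEq _ _ _ _ ▸ h).1 (Prod.mk.injEq _ _ _ _ ▸ h).2)
  obtain ⟨c, hc, hci, hcj⟩ := sparse_third_index hp2 hp'2 hne
  have hcm : c < m := by rcases hc with rfl | rfl <;> omega
  have hp2m : p.2 < m := hp2.trans hp1
  obtain ⟨y₁, y₂, hy⟩ := hTT3 p.1 hp1 p.2 hp2m c hcm (Nat.ne_of_gt hp2) (Ne.symm hci) (Ne.symm hcj)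
  have hsub : A p ∩ A p' ⊆
      (Xl.filter fun j => dist (x j) y₁ ≤ r₁) ∪ (Xl.filter fun j => dist (x j) y₂ ≤ r₁) := by
    intro q hq
    rw [Finset.mem_inter, hA p, hA p'] at hq
    obtain ⟨hq12, hq'⟩ := hq
    simp only [Finset.mem_inter] at hq12 hq'
    obtain ⟨⟨hq1, hqXl⟩, hq2, -⟩ := hq12
    have hqc : q ∈ SH c := by
      rcases hc with rfl | rfl
      · exact hq'.1.1
      · exact hq'.2.1
    have hq3 : q ∈ SH p.1 ∩ SH p.2 ∩ SH c :=
      Finset.mem_inter.2 ⟨Finset.mem_inter.2 ⟨hq1, hq2⟩, hqc⟩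
    rcases hy q hq3 with h | h
    · exact Finset.mem_union_left _ (Finset.mem_filter.2 ⟨hqXl, h⟩)
    · exact Finset.mem_union_right _ (Finset.mem_filter.2 ⟨hqXl, h⟩)
  have hsmall : ((A p ∩ A p').card : ℝ) < 2 * (c₂ * L) := by
    have h1 := hlight y₁
    have h2 := hlight y₂
    have h3 : ((A p ∩ A p').card : ℝ) ≤ ((Xl.filter fun j => dist (x j) y₁ ≤ r₁).card : ℝ) +
        ((Xl.filter fun j => dist (x j) y₂ ≤ r₁).card : ℝ) := by
      have h := (Finset.card_le_card hsub).trans (Finset.card_union_le _ _)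
      exact_mod_cast h
    linarith only [h1, h2, h3]
  /- (8) the contradiction -/
  have key := sparse_final_ineq hθ hL hm0 hσ₀ hc₂
  linarith only [key, hsmall, hbig']

end Summit.AtomisticToContinuum.Crystallization.Theorems.LjLaminarWindowsSketch

end
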